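import Mathlib
import Summits.Ventures.PercRepro2.HalfL

/-!
# The second sharp centring `c₂ = P(oL | PD) + P(oH | R)`: SHARP-L2 and `HalfL ⟸ SharpL2`
(blind cell PercRepro2, night-1 g36)

`SharpHalves.sharp_identity` writes the `L`-half in the two worlds `T = Q ∩ {a₃ ∈ H}`,
`R = Q ∩ {a₃ ∉ H}` as `P(T) P(R) ΓLc = 2 [D P(Q) · SL + B · X]`, with `SL` the sharp 4-term form,
`X = P(Q,bL) P(T) − P(T,bL) P(Q) ≥ 0` the BHK slack of `(bL, a₃ ∈ H)` and
`B = D P(T) P(R) (γ − c₀)` the centring bracket, `c₀ = P(oL | T) + P(oH | R)`.  The bracket splits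
(`centring_bracket_nonneg`'s `key`) as

  `B = P(R) · [P(PD,oL) P(T) − P(T,oL) D] + P(T) · [P(PD,oH) P(T′) − P(T′,oH) D]`
    `= D P(T) P(R) · (P(oL | PD) − P(oL | T))  +  D P(T) P(T′) · (P(oH | PD) − P(oH | T′))`,

both parts nonnegative (`ToL_mul_D_le` and its root swap).  SHARP-L (`0 ≤ SL`, no bracket at all)
is FALSE (`SharpHalvesRefutation`).  This file names the statement with the FIRST part only:

* **`oLSlack`** `= P(R) [P(PD,oL) P(T) − P(T,oL) D]`, **`oHSlack`** `= P(T) [P(PD,oH) P(T′) − P(T′,oH) D]`,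
  **`bLSlack`** `= X`;
* **`SL2`** `= D P(Q) · SL + oLSlack · X` and **`SharpL2 := 0 ≤ SL2`** — HALF-L at the centring
  `c₂ = P(oL | PD) + P(oH | R)` (`c₀ ≤ c₂ ≤ γ`): in the three-term form
  `μ(T) Cov_T(bL, oL) + μ(R) (−Cov_R(bL, oH)) + μ(T) μ(R) (P(bL|R) − P(bL|T)) (P(oL|PD) − P(oL|T)) ≥ 0`;
* **`sharp2_identity`**: `P(T) P(R) ΓLc = 2 (SL2 + oHSlack · X)`;
* **`GammaLc_nonneg_of_SharpL2`**, **`HalfL_of_SharpL2`**: SHARP-L2 ⟹ HALF-L on every instance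
  (the degenerate worlds `P(T) = 0`, `P(R) = 0` by `GammaLc_nonneg_of_T_null`,
  `GammaLc_eq_zero_of_R_null`); **`SharpL2_of_SharpL`**: SHARP-L ⟹ SHARP-L2;
* **`SharpL2_all`**, **`HalfL_all_of_SharpL2_all`**, **`HCov_all_of_SharpL2_all`**: the closure chain.

Census (night-1 g36, own code, kit adversary with exact re-check of every float negative, the same
jobs refuting SHARP-L hundreds of times as the control): SHARP-L2 and its sibling with
`P(bL | PD) − P(bL | T)` in place of `P(bL | R) − P(bL | T)` survive 78,000 weight climbs
(n = 5–9, the non-reducible class n = 7–8, K₆; j336096, j336098, j336102, j336153, j336154,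
j336156), 0 exact negatives; the centrings `P(oL|T) + P(oH|PD)` and `P(o ∈ U | T)` are refuted
(200 and 1 exact negatives).  SHARP-L2 is the strongest centring statement of the family standing.
-/

namespace Summit.Ventures.PercRepro2

namespace SharpHalves

open CovForm

section Defs

variable {V : Type*} {E : Type*} [Fintype E] [DecidableEq E] [DecidableEq V] {R : Type*}
  [Field R] [LinearOrder R]

/-- **The `oL`-slack** `P(R) [P(PD,oL) P(T) − P(T,oL) D] = D P(T) P(R) (P(oL | PD) − P(oL | T))`. -/
noncomputable def oLSlack (p : E → R) (ends : E → Sym2 V) (o a₁ a₂ a₃ : V) : R :=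
  prob p (avoidAll ends a₂ {a₁, a₃}) *
    (prob p (PDEvent ends a₁ a₂ a₃ ∩ connEvent ends a₁ o) * prob p (TEvent ends a₁ a₂ a₃) -
      prob p (TEvent ends a₁ a₂ a₃ ∩ connEvent ends a₁ o) * prob p (PDEvent ends a₁ a₂ a₃))

/-- **The `oH`-slack** `P(T) [P(PD,oH) P(T′) − P(T′,oH) D] = D P(T) P(T′) (P(oH | PD) − P(oH | T′))`. -/
noncomputable def oHSlack (p : E → R) (ends : E → Sym2 V) (o a₁ a₂ a₃ : V) : R :=
  prob p (TEvent ends a₁ a₂ a₃) *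
    (prob p (PDEvent ends a₁ a₂ a₃ ∩ connEvent ends a₂ o) * prob p (TEvent ends a₂ a₁ a₃) -
      prob p (TEvent ends a₂ a₁ a₃ ∩ connEvent ends a₂ o) * prob p (PDEvent ends a₁ a₂ a₃))

/-- **The `bL`-slack** `X = P(Q,bL) P(T) − P(T,bL) P(Q)` (BHK cross cluster, `TbL_mul_Q_le`). -/
noncomputable def bLSlack (p : E → R) (ends : E → Sym2 V) (a₁ a₂ a₃ b : V) : R :=
  prob p (avoidAll ends a₂ {a₁} ∩ connEvent ends a₁ b) * prob p (TEvent ends a₁ a₂ a₃) -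
    prob p (TEvent ends a₁ a₂ a₃ ∩ connEvent ends a₁ b) * prob p (avoidAll ends a₂ {a₁})

/-- **`SL2`** `= D P(Q) · SL + oLSlack · X`: the sharp form at the centring `c₂`. -/
noncomputable def SL2 (p : E → R) (ends : E → Sym2 V) (o a₁ a₂ a₃ b : V) : R :=
  prob p (PDEvent ends a₁ a₂ a₃) * prob p (avoidAll ends a₂ {a₁}) * SL p ends o a₁ a₂ a₃ b +
    oLSlack p ends o a₁ a₂ a₃ * bLSlack p ends a₁ a₂ a₃ b

/-- **SHARP-L2**: `0 ≤ SL2` (HALF-L at the centring `c₂ = P(oL | PD) + P(oH | R)`). -/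
def SharpL2 (p : E → R) (ends : E → Sym2 V) (o a₁ a₂ a₃ b : V) : Prop :=
  0 ≤ SL2 p ends o a₁ a₂ a₃ b

end Defs

section Closure

variable (R : Type*) [Field R] [LinearOrder R] [IsStrictOrderedRing R]

/-- **SHARP-L2 for every finite graph and every labelling.** -/
def SharpL2_all : Prop :=
  ∀ (V E : Type) [Fintype V] [DecidableEq V] [Fintype E] [DecidableEq E]
    (ends : E → Sym2 V) (p : E → R), IsProbVec p →
    ∀ o a₁ a₂ a₃ b : V, a₁ ≠ a₂ → a₁ ≠ a₃ → a₂ ≠ a₃ → o ≠ a₁ → o ≠ a₂ → o ≠ a₃ → o ≠ b →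
      b ≠ a₁ → b ≠ a₂ → b ≠ a₃ → SharpL2 p ends o a₁ a₂ a₃ b

end Closure

section Identity

variable {V : Type*} {E : Type*} [Fintype E] [DecidableEq E] [DecidableEq V] {R : Type*}
  [Field R] [LinearOrder R] [IsStrictOrderedRing R]

omit [LinearOrder R] [IsStrictOrderedRing R] in
/-- **The second sharp identity**: `P(T) P(R) · ΓLc = 2 (SL2 + oHSlack · X)`. -/
theorem sharp2_identity (p : E → R) (ends : E → Sym2 V) (o a₁ a₂ a₃ b : V) :
    prob p (TEvent ends a₁ a₂ a₃) * prob p (avoidAll ends a₂ {a₁, a₃}) *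
        GammaLc p ends o a₁ a₂ a₃ b =
      2 * (SL2 p ends o a₁ a₂ a₃ b + oHSlack p ends o a₁ a₂ a₃ * bLSlack p ends a₁ a₂ a₃ b) := by
  rw [sharp_identity p ends o a₁ a₂ a₃ b]
  unfold SL2 oLSlack oHSlack bLSlack Do
  rw [prob_R_univ p ends a₁ a₂ a₃, prob_R_eq p ends a₁ a₂ a₃ (connEvent ends a₂ o)]
  ring

end Identity

section Facts

variable {V : Type*} {E : Type*} [Fintype E] [DecidableEq E] [Fintype V] [DecidableEq V]
  {R : Type*} [Field R] [LinearOrder R] [IsStrictOrderedRing R]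

/-- `0 ≤ oLSlack` (`ToL_mul_D_le`). -/
lemma oLSlack_nonneg (p : E → R) (hp : IsProbVec p) (ends : E → Sym2 V) (o a₁ a₂ a₃ : V) :
    0 ≤ oLSlack p ends o a₁ a₂ a₃ := by
  unfold oLSlack
  exact mul_nonneg (prob_nonneg hp _) (sub_nonneg.mpr (ToL_mul_D_le p hp ends o a₁ a₂ a₃))

/-- `0 ≤ oHSlack` (the root swap of `ToL_mul_D_le`). -/
lemma oHSlack_nonneg (p : E → R) (hp : IsProbVec p) (ends : E → Sym2 V) (o a₁ a₂ a₃ : V) :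
    0 ≤ oHSlack p ends o a₁ a₂ a₃ := by
  unfold oHSlack
  have h := ToL_mul_D_le p hp ends o a₂ a₁ a₃
  rw [PDEvent_root_swap] at h
  exact mul_nonneg (prob_nonneg hp _) (sub_nonneg.mpr h)

/-- `0 ≤ bLSlack` (`TbL_mul_Q_le`). -/
lemma bLSlack_nonneg (p : E → R) (hp : IsProbVec p) (ends : E → Sym2 V) (a₁ a₂ a₃ b : V) :
    0 ≤ bLSlack p ends a₁ a₂ a₃ b := by
  unfold bLSlack
  exact sub_nonneg.mpr (TbL_mul_Q_le p hp ends a₁ a₂ a₃ b)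

/-- **SHARP-L ⟹ SHARP-L2** (`SL2 = D P(Q) SL + oLSlack · X`, both extra factors nonnegative). -/
theorem SharpL2_of_SharpL (p : E → R) (hp : IsProbVec p) (ends : E → Sym2 V) (o a₁ a₂ a₃ b : V)
    (h : SharpL p ends o a₁ a₂ a₃ b) : SharpL2 p ends o a₁ a₂ a₃ b := by
  unfold SharpL2 SL2
  unfold SharpL at h
  exact add_nonneg (mul_nonneg (mul_nonneg (prob_nonneg hp _) (prob_nonneg hp _)) h)
    (mul_nonneg (oLSlack_nonneg p hp ends o a₁ a₂ a₃) (bLSlack_nonneg p hp ends a₁ a₂ a₃ b))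

end Facts

section Reduction

variable {V : Type*} {E : Type*} [Fintype E] [DecidableEq E] [Fintype V] [DecidableEq V]
  {R : Type*} [Field R] [LinearOrder R] [IsStrictOrderedRing R]

/-- **`0 ≤ ΓLc` from SHARP-L2** in the non-degenerate worlds `P(T), P(R) > 0`. -/
theorem GammaLc_nonneg_of_SharpL2 (p : E → R) (hp : IsProbVec p) (ends : E → Sym2 V)
    (o a₁ a₂ a₃ b : V) (hT : 0 < prob p (TEvent ends a₁ a₂ a₃))
    (hR : 0 < prob p (avoidAll ends a₂ {a₁, a₃})) (h : SharpL2 p ends o a₁ a₂ a₃ b) :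
    0 ≤ GammaLc p ends o a₁ a₂ a₃ b := by
  have hid := sharp2_identity p ends o a₁ a₂ a₃ b
  unfold SharpL2 at h
  have h2 := mul_nonneg (oHSlack_nonneg p hp ends o a₁ a₂ a₃) (bLSlack_nonneg p hp ends a₁ a₂ a₃ b)
  have hpos : 0 ≤ prob p (TEvent ends a₁ a₂ a₃) * prob p (avoidAll ends a₂ {a₁, a₃}) *
      GammaLc p ends o a₁ a₂ a₃ b := by
    rw [hid]
    linarith
  exact (mul_nonneg_iff_of_pos_left (mul_pos hT hR)).1 hpos

/-- **HALF-L ⟸ SHARP-L2** on every instance (the degenerate worlds included). -/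
theorem HalfL_of_SharpL2 (p : E → R) (hp : IsProbVec p) (ends : E → Sym2 V) (o a₁ a₂ a₃ b : V)
    (h : SharpL2 p ends o a₁ a₂ a₃ b) : HalfL p ends o a₁ a₂ a₃ b := by
  unfold HalfL
  rcases (prob_nonneg hp (TEvent ends a₁ a₂ a₃)).lt_or_eq with hT | hT
  · rcases (prob_nonneg hp (avoidAll ends a₂ {a₁, a₃})).lt_or_eq with hR | hR
    · exact GammaLc_nonneg_of_SharpL2 p hp ends o a₁ a₂ a₃ b hT hR h
    · rw [GammaLc_eq_zero_of_R_null p hp ends o a₁ a₂ a₃ b hR.symm]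
  · exact GammaLc_nonneg_of_T_null p hp ends o a₁ a₂ a₃ b hT.symm

end Reduction

section ClosureChain

variable (R : Type*) [Field R] [LinearOrder R] [IsStrictOrderedRing R]

/-- **`HalfL_all ⟸ SharpL2_all`.** -/
theorem HalfL_all_of_SharpL2_all (h : SharpL2_all R) : HalfL_all R := by
  intro V E _ _ _ _ ends p hp o a₁ a₂ a₃ b h12 h13 h23 ho1 ho2 ho3 hob hb1 hb2 hb3
  exact HalfL_of_SharpL2 p hp ends o a₁ a₂ a₃ b
    (h V E ends p hp o a₁ a₂ a₃ b h12 h13 h23 ho1 ho2 ho3 hob hb1 hb2 hb3)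

/-- **`HCov_all ⟸ SharpL2_all`**: (HCOV) for every finite graph from SHARP-L2 for every finite graph
and labelling (the `H`-half is the root swap). -/
theorem HCov_all_of_SharpL2_all (h : SharpL2_all R) : HCov_all R :=
  HCov_all_of_HalfL_all R (HalfL_all_of_SharpL2_all R h)

end ClosureChain

end SharpHalves

end Summit.Ventures.PercRepro2
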